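import Literature.Geometry.Lorentzian.KerrPeel
import HarnessLib

/-!
# The collar climb over a boosted Kerr–Schild background in a time-oriented spacetime

`KerrPeel.collarClimb_model`: for any chart `Φ` of any time-oriented `Spacetime 4` on a model
background `B` whose form / time / radius are those of the boosted Kerr–Schild background with motion
`(Λ, c)` and whose domain contains the two-sided collar `{r > r₊ − h}` (`M, h > 0`, `h < r₊`; the spin
`a` is arbitrary — sub-extremality is NOT used), and for every delay `T₀`, slope constant `c_s > 0` and
bound `K`, there is `ε > 0` such that: if the `C¹` slab deviation is `≤ ε` on the late collar
`{t* ≥ τ₁, r ≤ r₊ + h}`, `dΦ(ΛV)` is future-directed there, and at every late collar point with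
`r₊ < r ≤ r₊ + h` some rest vector `v` with `v⁰ = 1`, `‖v‖ ≤ K` has `g(dΦ Λv, dΦ Λv) ≤ −c_s (r − r₊)`
and `dr(v) ≥ c_s (r − r₊)` (a SLOPE FIELD), then every late `w` with `r₊ < r(w) ≤ r₊ + h/2` causally
precedes a chart point `w'` with `r(w') = r₊ + h/2` and `t*(w') ≥ t*(w) + T₀`.

Mechanism (classical): frozen-direction lab segments `x + θΛv`; along a piece the background form and
radius differential move by `< margin/4` (the Heine–Cantor moduli of `KerrPeel.modulus_package` on
the compact time-normalised shell, the data being `t*`-independent) and the deviation moves by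
`≤ ε θ ‖Λv‖` (`KerrPeel.deviation_segment_lipschitz`), so velocities stay timelike and the rest
radius is monotone (`KerrPeel.radius_segment_mvt`); pieces are cut on level sets by the intermediate
value theorem, are causal by `BoostedKerrLegs.leg_two_causal`, and are chained by `J⁺ ∘ J⁺ = J⁺`; the
delay `T₀` is produced by `⌈T₀ / t_gain⌉` out–in cycles between the levels `r₊ + h/2` and
`r₊ + 3h/4`, each gaining rest time `≥ (h/4)/L`.  O'Neill 1983, Ch. 5 (Lemmas 5.26, 5.29), Ch. 14
(p. 402, Cor. 14.1); Dafermos–Rodnianski arXiv:0811.0354, §5.1.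

Provenance: decomp-fsc lens-3 g32 side file `HorizonPeeling32.lean` ll. 668–1281 (the theorem
`KerrPeel.collarClimb_model`, farm-checked there), re-homed verbatim up to line wrapping; the proof is
one ≈ 600-line tactic block and keeps its scoped heartbeat budget (`maxHeartbeats 1600000`, ≈ 8× the
default; splitting it into lemmas would change nothing mathematically).

NOT here: the route-side corollary for vacuum Cauchy developments (a Theses-side one-liner), the
anchor (`KerrAnchor`) and slope (`KerrSlope`) legs that produce the slope field.
-/

noncomputable section

open scoped Topology Manifold ContDiff ENNReal
open Filter Set Function

namespace Literature.Geometry.Lorentzian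

namespace KerrPeel

open Metric

-- typeclass search through nested operator types `E4 →L[ℝ] E4 →L[ℝ] ℝ` (as in `BoostedKerrCausalLegs`)
set_option maxSynthPendingDepth 3

variable {M a : ℝ} {x : E4}

section Chart

variable (𝓢 : Spacetime.{0} 4)

set_option maxHeartbeats 1600000 in
/-- **The collar climb in a time-oriented spacetime** (content of the leg HP given a slope field; for any
chart `Φ` of any `Spacetime 4` on a model background `B` whose form / time / radius are those of the
boosted Kerr–Schild background with motion `(Λ, c)` and whose domain contains the two-sided collar
`{r > r₊ − h}`).  For `M, h, c_s > 0`, `h < r₊`, `T₀`, `K` there is `ε > 0` such that: if the `C¹` slab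
deviation is `≤ ε` on the late collar `{t* ≥ τ₁, r ≤ r₊ + h}`, `dΦ(ΛV)` is future-directed there, and at
every late collar point with `r₊ < r ≤ r₊ + h` some rest vector `v` with `v⁰ = 1`, `‖v‖ ≤ K` has
`g(dΦ Λv, dΦ Λv) ≤ −c_s (r − r₊)` and `dr(v) ≥ c_s (r − r₊)`, then every late `w` with
`r₊ < r(w) ≤ r₊ + h/2` causally precedes a chart point `w'` with `r(w') = r₊ + h/2`, `t*(w') ≥ t*(w) + T₀`.
Frozen-direction segments, Heine–Cantor moduli, mean value and intermediate value theorems, out–in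
cycles.  O'Neill 1983, Ch. 5 (Lemmas 5.26, 5.29: timecones, causal character is an open
condition), Ch. 14 (p. 402 and Cor. 14.1: the causality relations, `J⁺ ∘ J⁺ = J⁺`), applied on the
two-sided Kerr–Schild horizon collar of Dafermos–Rodnianski arXiv:0811.0354, §5.1 (the Kerr metric in
regular coordinates across `𝓗⁺`, `t*`-foliation). [cite: ONeillSemiRiemannian1983, Ch. 14, p. 402 (Cor. 14.1)] -/
theorem collarClimb_model (B : ModelBackground) (Λ : lorentzGroup) (c : E4) {M : ℝ} (a : ℝ) (hM : 0 < M)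
    {h : ℝ} (hh : 0 < h) (hhr : h < Kerr.rPlus M a)
    (hBb : B.bilin = boostedKerrBilin Λ c M a) (hBt : ∀ x : E4, B.time x = poincareInv Λ c x 0)
    (hBr : ∀ x : E4, B.radius x = Kerr.radius a (poincareInv Λ c x))
    (hBd : ∀ z : E4, Kerr.rPlus M a - h < Kerr.radius a (poincareInv Λ c z) → z ∈ (B.domain : Set E4))
    (T₀ : ℝ) {cₛ : ℝ} (K : ℝ) (hcₛ : 0 < cₛ) :
    ∃ ε : ℝ, 0 < ε ∧
    ∀ Φ : B.domain → 𝓢.carrier, ContMDiff 𝓘(ℝ, E4) (𝓡 4) ((⊤ : ℕ∞) : WithTop ℕ∞) Φ →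
    ∀ τ₁ : ℝ,
    (∀ τ : ℝ, τ₁ ≤ τ → 𝓢.truncDeviationCk B Φ 1 (Kerr.rPlus M a + h) τ ≤ ENNReal.ofReal ε) →
    (∀ w : B.domain, τ₁ ≤ B.time w.1 → B.radius w.1 ≤ Kerr.rPlus M a + h →
      𝓢.timeOrientation.IsFutureDirected
        (mfderiv 𝓘(ℝ, E4) (𝓡 4) Φ w ((Λ : E4 ≃L[ℝ] E4) (Kerr.timeVector M a (poincareInv Λ c w.1))))) →
    (∀ w : B.domain, τ₁ ≤ B.time w.1 → Kerr.rPlus M a < B.radius w.1 → B.radius w.1 ≤ Kerr.rPlus M a + h →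
      ∃ v : E4, v 0 = 1 ∧ ‖v‖ ≤ K ∧
        𝓢.metric.val (Φ w) (mfderiv 𝓘(ℝ, E4) (𝓡 4) Φ w ((Λ : E4 ≃L[ℝ] E4) v))
          (mfderiv 𝓘(ℝ, E4) (𝓡 4) Φ w ((Λ : E4 ≃L[ℝ] E4) v)) ≤ -(cₛ * (B.radius w.1 - Kerr.rPlus M a)) ∧
        cₛ * (B.radius w.1 - Kerr.rPlus M a) ≤
          Kerr.radiusGrad a (E4.spatial (poincareInv Λ c w.1)) (E4.spatial v)) →
    ∀ w : B.domain, τ₁ ≤ B.time w.1 → Kerr.rPlus M a < B.radius w.1 →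
      B.radius w.1 ≤ Kerr.rPlus M a + h / 2 →
      ∃ w' : B.domain, B.radius w'.1 = Kerr.rPlus M a + h / 2 ∧ B.time w.1 + T₀ ≤ B.time w'.1 ∧
        Φ w' ∈ 𝓢.metric.causalFuture 𝓢.timeOrientation {Φ w} := by
  -- the outer horizon radius `rp` and the shell `rp ≤ r ≤ rp + h`
  obtain ⟨rp, hrpdef⟩ : ∃ rp : ℝ, Kerr.rPlus M a = rp := ⟨_, rfl⟩
  have hrpM : M ≤ rp := hrpdef ▸ le_rPlus M a
  have hrp0 : 0 < rp := lt_of_lt_of_le hM hrpM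
  rw [hrpdef] at hhr hBd
  simp only [hrpdef]
  obtain ⟨CV, CW, hCV, hCW, hbd⟩ := bound_package M a (r₁ := rp) (r₂ := rp + h) hrp0 (by linarith)
  have hCV0 : 0 < CV := lt_of_lt_of_le one_pos hCV
  have hCW0 : 0 < CW := lt_of_lt_of_le one_pos hCW
  -- the red-shift constant `cH ≤ 2H` on the shell
  obtain ⟨cH, hcHdef⟩ : ∃ cH : ℝ, 2 * M * rp / (2 * (rp + h) ^ 2 + a ^ 2) = cH := ⟨_, rfl⟩
  have hcH0 : 0 < cH := by rw [← hcHdef]; positivity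
  have hcH : ∀ x : E4, rp ≤ Kerr.radius a x → Kerr.radius a x ≤ rp + h → cH ≤ 2 * Kerr.scalarH M a x :=
    fun x h1 h2 => hcHdef ▸ two_mul_scalarH_ge hM hrp0 h1 h2
  -- the Lorentz factor
  obtain ⟨KΛ, hKΛ⟩ : ∃ K : ℝ, ‖((Λ : E4 ≃L[ℝ] E4) : E4 →L[ℝ] E4)‖ = K := ⟨_, rfl⟩
  have hK1 : 1 ≤ KΛ := by rw [← hKΛ]; exact BoostedKerrLegs.one_le_norm_lorentz Λ
  have hK0 : 0 < KΛ := lt_of_lt_of_le one_pos hK1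
  have hΛle : ∀ v : E4, ‖(Λ : E4 ≃L[ℝ] E4) v‖ ≤ KΛ * ‖v‖ := fun v => by
    rw [← hKΛ]
    exact ((Λ : E4 ≃L[ℝ] E4) : E4 →L[ℝ] E4).le_opNorm v
  -- the slope-vector size
  set K₁ : ℝ := max K 1 with hK₁
  have hK₁1 : 1 ≤ K₁ := le_max_right _ _
  have hK₁K : K ≤ K₁ := le_max_left _ _
  have hK₁0 : 0 < K₁ := lt_of_lt_of_le one_pos hK₁1
  -- the deviation threshold
  obtain ⟨ε, hεdef⟩ : ∃ ε : ℝ, ε = min (1 / (4 * KΛ ^ 2 * CV ^ 2)) (1 / (2 * KΛ ^ 2 * CV * K₁)) := ⟨_, rfl⟩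
  have hε0 : 0 < ε := by rw [hεdef]; positivity
  have hε1 : ε ≤ 1 / (4 * KΛ ^ 2 * CV ^ 2) := by rw [hεdef]; exact min_le_left _ _
  have hε2 : ε ≤ 1 / (2 * KΛ ^ 2 * CV * K₁) := by rw [hεdef]; exact min_le_right _ _
  have hεVV : ∀ V : E4, ‖V‖ ≤ CV →
      ε * ‖(Λ : E4 ≃L[ℝ] E4) V‖ * ‖(Λ : E4 ≃L[ℝ] E4) V‖ ≤ 1 / 4 := by
    intro V hV
    have h2 : ‖(Λ : E4 ≃L[ℝ] E4) V‖ ≤ KΛ * CV := (hΛle V).trans (mul_le_mul_of_nonneg_left hV hK0.le)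
    have h0' := norm_nonneg ((Λ : E4 ≃L[ℝ] E4) V)
    calc ε * ‖(Λ : E4 ≃L[ℝ] E4) V‖ * ‖(Λ : E4 ≃L[ℝ] E4) V‖
        ≤ (1 / (4 * KΛ ^ 2 * CV ^ 2)) * (KΛ * CV) * (KΛ * CV) :=
          mul_le_mul (mul_le_mul hε1 h2 h0' (by positivity)) h2 h0' (by positivity)
      _ = 1 / 4 := by field_simp
  have hεVu : ∀ V : E4, ‖V‖ ≤ CV → ∀ v : E4, ‖v‖ ≤ K₁ →
      ε * ‖(Λ : E4 ≃L[ℝ] E4) V‖ * ‖(Λ : E4 ≃L[ℝ] E4) v‖ ≤ 1 / 2 := by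
    intro V hV v hv
    have h1 : ‖(Λ : E4 ≃L[ℝ] E4) v‖ ≤ KΛ * K₁ := (hΛle v).trans (mul_le_mul_of_nonneg_left hv hK0.le)
    have h2 : ‖(Λ : E4 ≃L[ℝ] E4) V‖ ≤ KΛ * CV := (hΛle V).trans (mul_le_mul_of_nonneg_left hV hK0.le)
    have h0 := norm_nonneg ((Λ : E4 ≃L[ℝ] E4) v)
    have h0' := norm_nonneg ((Λ : E4 ≃L[ℝ] E4) V)
    calc ε * ‖(Λ : E4 ≃L[ℝ] E4) V‖ * ‖(Λ : E4 ≃L[ℝ] E4) v‖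
        ≤ (1 / (2 * KΛ ^ 2 * CV * K₁)) * (KΛ * CV) * (KΛ * K₁) :=
          mul_le_mul (mul_le_mul hε2 h2 h0' (by positivity)) h1 h0 (by positivity)
      _ = 1 / 2 := by field_simp
  refine ⟨ε, hε0, ?_⟩
  intro Φ hΦ τ₁ hdev hfd hslope w hw0 hw1 hw2
  -- background form on boosted vectors, time and radius along lab segments
  have hBuv : ∀ (x : E4) (v v' : E4), B.bilin x ((Λ : E4 ≃L[ℝ] E4) v) ((Λ : E4 ≃L[ℝ] E4) v') =
      Kerr.bilin M a (poincareInv Λ c x) v v' := fun x v v' => by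
    rw [hBb, boostedKerrBilin_apply_boost]
  have hrest : ∀ (x v : E4) (θ : ℝ), poincareInv Λ c (x + θ • (Λ : E4 ≃L[ℝ] E4) v) =
      poincareInv Λ c x + θ • v := fun x v θ => poincareInv_add_smul Λ c x v θ
  have htime_seg : ∀ (x v : E4) (θ : ℝ), B.time (x + θ • (Λ : E4 ≃L[ℝ] E4) v) =
      poincareInv Λ c x 0 + θ * v 0 := fun x v θ => by
    rw [hBt, hrest]
    simp only [PiLp.add_apply, PiLp.smul_apply, smul_eq_mul]
  have hrad_seg : ∀ (x v : E4) (θ : ℝ), B.radius (x + θ • (Λ : E4 ≃L[ℝ] E4) v) =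
      Kerr.radius a (poincareInv Λ c x + θ • v) := fun x v θ => by rw [hBr, hrest]
  have hsmooth : ∀ x : E4, 0 < Kerr.radius a (poincareInv Λ c x) →
      ContDiffAt ℝ ((⊤ : ℕ∞) : WithTop ℕ∞) B.bilin x := fun x hx => by
    rw [hBb]; exact contDiffAt_boostedKerrBilin Λ c M a hx
  -- pointwise deviation bounds on the late collar
  have hdv : ∀ x : B.domain, τ₁ ≤ B.time x.1 → B.radius x.1 ≤ rp + h →
      ‖𝓢.deviation B Φ x‖ ≤ ε ∧ ‖fderiv ℝ (𝓢.deviationExtend B Φ) x.1‖ ≤ ε :=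
    fun x hx0 hx1 => dev_bounds 𝓢 B Φ hε0.le hdev x hx0 hx1
  -- the margins of this climb
  obtain ⟨d₀, hd₀def⟩ : ∃ d : ℝ, B.radius w.1 - rp = d := ⟨_, rfl⟩
  have hd₀ : 0 < d₀ := by rw [← hd₀def]; linarith
  set dm : ℝ := min d₀ (h / 2) with hdm
  have hdm0 : 0 < dm := lt_min hd₀ (by linarith)
  have hdmd₀ : dm ≤ d₀ := min_le_left _ _
  have hdmh : dm ≤ h / 2 := min_le_right _ _
  set m : ℝ := cₛ * dm with hmdef
  have hm0 : 0 < m := mul_pos hcₛ hdm0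
  -- one modulus for both kinds of pieces
  set mt : ℝ := min (m / (4 * K₁ ^ 2)) (min (1 / (4 * CV ^ 2)) (cH / (2 * CV))) with hmt
  have hmt0 : 0 < mt := lt_min (by positivity) (lt_min (by positivity) (by positivity))
  have hmt1 : mt ≤ m / (4 * K₁ ^ 2) := min_le_left _ _
  have hmt2 : mt ≤ 1 / (4 * CV ^ 2) := (min_le_right _ _).trans (min_le_left _ _)
  have hmt3 : mt ≤ cH / (2 * CV) := (min_le_right _ _).trans (min_le_right _ _)
  obtain ⟨ρ, hρ0, hρ1, hmod⟩ := modulus_package M a (r₁ := rp) (r₂ := rp + h) hrp0 (by linarith) hmt0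
  -- piece lengths, gains per piece, radius speed bound, time gain per cycle
  set ℓ₁ : ℝ := min (ρ / (2 * K₁)) (m / (4 * ε * KΛ ^ 3 * K₁ ^ 3)) with hℓ₁
  have hℓ₁0 : 0 < ℓ₁ := lt_min (by positivity) (by positivity)
  have hℓ₁ρ : ℓ₁ * K₁ ≤ ρ / 2 := by
    have : ℓ₁ ≤ ρ / (2 * K₁) := min_le_left _ _
    calc ℓ₁ * K₁ ≤ ρ / (2 * K₁) * K₁ := mul_le_mul_of_nonneg_right this hK₁0.le
      _ = ρ / 2 := by field_simp
  have hℓ₁ε : ε * (KΛ * K₁) * ℓ₁ * (KΛ * K₁) * (KΛ * K₁) ≤ m / 4 := by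
    have : ℓ₁ ≤ m / (4 * ε * KΛ ^ 3 * K₁ ^ 3) := min_le_right _ _
    calc ε * (KΛ * K₁) * ℓ₁ * (KΛ * K₁) * (KΛ * K₁) = (ε * KΛ ^ 3 * K₁ ^ 3) * ℓ₁ := by ring
      _ ≤ (ε * KΛ ^ 3 * K₁ ^ 3) * (m / (4 * ε * KΛ ^ 3 * K₁ ^ 3)) :=
          mul_le_mul_of_nonneg_left this (by positivity)
      _ = m / 4 := by field_simp
  set ℓ₂ : ℝ := ρ / (2 * CV) with hℓ₂
  have hℓ₂0 : 0 < ℓ₂ := by positivity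
  have hℓ₂ρ : ℓ₂ * CV = ρ / 2 := by rw [hℓ₂]; field_simp
  set η₁ : ℝ := m / 2 * ℓ₁ with hη₁
  have hη₁0 : 0 < η₁ := by positivity
  set η₂ : ℝ := cH / 2 * ℓ₂ with hη₂
  have hη₂0 : 0 < η₂ := by positivity
  set L : ℝ := CW * K₁ + m with hL
  have hL0 : 0 < L := by positivity
  set tg : ℝ := h / 4 / L with htg
  have htg0 : 0 < tg := by positivity
  /- OUT PIECE: from a late chart point `p` with `rp + dm ≤ r(p) ≤ R ≤ rp + h`, a frozen segment along
  `Λ v(p)` cut at `r = R`: causal future, radius nondecreasing with gain `≥ η₁` unless cut, rest time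
  gain `≥ (radius gain)/L`. -/
  have stepOut : ∀ p : B.domain, τ₁ ≤ B.time p.1 → rp + dm ≤ B.radius p.1 → ∀ R : ℝ,
      B.radius p.1 ≤ R → R ≤ rp + h →
      ∃ q : B.domain, Φ q ∈ 𝓢.metric.causalFuture 𝓢.timeOrientation {Φ p} ∧
        τ₁ ≤ B.time q.1 ∧ rp + dm ≤ B.radius q.1 ∧ B.radius q.1 ≤ R ∧
        B.time p.1 + (B.radius q.1 - B.radius p.1) / L ≤ B.time q.1 ∧
        (B.radius q.1 = R ∨ B.radius p.1 + η₁ ≤ B.radius q.1) := by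
    intro p hp0 hp1 R hpR hR
    obtain ⟨p', hp'⟩ : ∃ p' : E4, poincareInv Λ c p.1 = p' := ⟨_, rfl⟩
    have hp0' : τ₁ ≤ p' 0 := by rw [← hp', ← hBt]; exact hp0
    have hradp : B.radius p.1 = Kerr.radius a p' := by rw [hBr, hp']
    have hp1' : rp + dm ≤ Kerr.radius a p' := hradp ▸ hp1
    have hpR' : Kerr.radius a p' ≤ R := hradp ▸ hpR
    have hr0' : 0 < Kerr.radius a p' := by linarith
    have hprp : rp ≤ Kerr.radius a p' := by linarith
    have hph : Kerr.radius a p' ≤ rp + h := hpR'.trans hR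
    -- the slope vector at `p`
    obtain ⟨v, hv0, hvK, hgvv, hdrv⟩ := hslope p hp0 (by linarith) (by linarith)
    have hvK₁ : ‖v‖ ≤ K₁ := hvK.trans hK₁K
    rw [hp'] at hdrv
    have hm_le : m ≤ cₛ * (B.radius p.1 - rp) := by
      rw [hmdef]; exact mul_le_mul_of_nonneg_left (by linarith) hcₛ.le
    have hgvv' : 𝓢.metric.val (Φ p) (mfderiv 𝓘(ℝ, E4) (𝓡 4) Φ p ((Λ : E4 ≃L[ℝ] E4) v))
        (mfderiv 𝓘(ℝ, E4) (𝓡 4) Φ p ((Λ : E4 ≃L[ℝ] E4) v)) ≤ -m := by linarith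
    have hdr0 : m ≤ Kerr.bilin M a p' (Kerr.radiusGradVector M a p') v := by
      rw [Kerr.bilin_radiusGradVector hr0']; linarith
    obtain ⟨u, hu⟩ : ∃ u : E4, (Λ : E4 ≃L[ℝ] E4) v = u := ⟨_, rfl⟩
    have huK : ‖u‖ ≤ KΛ * K₁ := by
      rw [← hu]; exact (hΛle v).trans (mul_le_mul_of_nonneg_left hvK₁ hK0.le)
    rw [hu] at hgvv'
    -- rest data along the lab segment `p + θ u`
    have hrest' : ∀ θ : ℝ, poincareInv Λ c (p.1 + θ • u) = p' + θ • v := fun θ => by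
      rw [← hu, hrest, hp']
    have hBuu : ∀ θ : ℝ, B.bilin (p.1 + θ • u) u u = Kerr.bilin M a (p' + θ • v) v v := fun θ => by
      rw [← hu, hBuv, hu, hrest']
    have htime_eq : ∀ θ : ℝ, B.time (p.1 + θ • u) = p' 0 + θ := fun θ => by
      rw [← hu, htime_seg, hp', hv0, mul_one]
    have hradB : ∀ θ : ℝ, B.radius (p.1 + θ • u) = Kerr.radius a (p' + θ • v) := fun θ => by
      rw [← hu, hrad_seg, hp']
    -- Kerr moduli along the rest segment `p' + θ v`, `0 ≤ θ ≤ ℓ₁`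
    have hclose : ∀ θ ∈ Icc (0 : ℝ) ℓ₁, ‖tn (p' + θ • v) - tn p'‖ < ρ := by
      intro θ hθ
      rw [tn_add_smul, add_sub_cancel_left, norm_smul, Real.norm_eq_abs, abs_of_nonneg hθ.1]
      calc θ * ‖tn v‖ ≤ ℓ₁ * K₁ := mul_le_mul hθ.2 ((norm_tn_le v).trans hvK₁) (norm_nonneg _) hℓ₁0.le
        _ ≤ ρ / 2 := hℓ₁ρ
        _ < ρ := by linarith
    have hkerr : ∀ θ ∈ Icc (0 : ℝ) ℓ₁, 0 < Kerr.radius a (p' + θ • v) ∧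
        Kerr.bilin M a (p' + θ • v) v v ≤ Kerr.bilin M a p' v v + m / 4 ∧
        m / 2 ≤ Kerr.bilin M a (p' + θ • v) (Kerr.radiusGradVector M a (p' + θ • v)) v ∧
        Kerr.bilin M a (p' + θ • v) (Kerr.radiusGradVector M a (p' + θ • v)) v ≤ L := by
      intro θ hθ
      obtain ⟨hpos, hG, hF⟩ := hmod p' hprp hph (p' + θ • v) (hclose θ hθ)
      have hmK : mt * ‖v‖ * ‖v‖ ≤ m / 4 := by
        calc mt * ‖v‖ * ‖v‖ ≤ m / (4 * K₁ ^ 2) * K₁ * K₁ :=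
              mul_le_mul (mul_le_mul hmt1 hvK₁ (norm_nonneg _) (by positivity)) hvK₁ (norm_nonneg _)
                (by positivity)
          _ = m / 4 := by field_simp
      have hmK' : mt * ‖v‖ ≤ m / 4 := by
        calc mt * ‖v‖ ≤ m / (4 * K₁ ^ 2) * K₁ := mul_le_mul hmt1 hvK₁ (norm_nonneg _) (by positivity)
          _ = m / 4 * (1 / K₁) := by field_simp
          _ ≤ m / 4 * 1 := by
              apply mul_le_mul_of_nonneg_left _ (by positivity)
              rw [div_le_iff₀ hK₁0]; linarith
          _ = m / 4 := mul_one _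
      refine ⟨hpos, ?_, ?_, ?_⟩
      · have h1 := bilin_sub_apply_le (Kerr.bilin M a (p' + θ • v)) (Kerr.bilin M a p') v v
        have h2 : ‖Kerr.bilin M a (p' + θ • v) - Kerr.bilin M a p'‖ * ‖v‖ * ‖v‖ ≤ mt * ‖v‖ * ‖v‖ := by
          gcongr
        linarith
      · have h1 := (form_sub_apply_le (Kerr.bilin M a (p' + θ • v) (Kerr.radiusGradVector M a (p' + θ • v)))
          (Kerr.bilin M a p' (Kerr.radiusGradVector M a p')) v).1
        have h2 : ‖Kerr.bilin M a (p' + θ • v) (Kerr.radiusGradVector M a (p' + θ • v)) -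
            Kerr.bilin M a p' (Kerr.radiusGradVector M a p')‖ * ‖v‖ ≤ mt * ‖v‖ := by gcongr
        linarith
      · have h1 := (form_sub_apply_le (Kerr.bilin M a (p' + θ • v) (Kerr.radiusGradVector M a (p' + θ • v)))
          (Kerr.bilin M a p' (Kerr.radiusGradVector M a p')) v).2
        have h2 : ‖Kerr.bilin M a (p' + θ • v) (Kerr.radiusGradVector M a (p' + θ • v)) -
            Kerr.bilin M a p' (Kerr.radiusGradVector M a p')‖ * ‖v‖ ≤ mt * ‖v‖ := by gcongr
        have h3 : Kerr.bilin M a p' (Kerr.radiusGradVector M a p') v ≤ CW * K₁ :=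
          (Real.le_norm_self _).trans (((Kerr.bilin M a p' (Kerr.radiusGradVector M a p')).le_opNorm v).trans
            (mul_le_mul (hbd p' hprp hph).2 hvK₁ (norm_nonneg _) hCW0.le))
        have h4 : m / 4 ≤ m := by linarith
        linarith
    -- radius monotonicity and speed along the rest segment
    have hgrow := radius_segment_mvt M a p' v (fun θ hθ => (hkerr θ hθ).1)
      (fun θ hθ => (hkerr θ hθ).2.2.1) (fun θ hθ => (hkerr θ hθ).2.2.2)
    -- the cut parameter
    have hθs : ∃ θs ∈ Icc (0 : ℝ) ℓ₁, Kerr.radius a (p' + θs • v) ≤ R ∧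
        (Kerr.radius a (p' + θs • v) = R ∨ (θs = ℓ₁ ∧ Kerr.radius a (p' + ℓ₁ • v) < R)) := by
      by_cases hc : R ≤ Kerr.radius a (p' + ℓ₁ • v)
      · have h0 : (fun θ : ℝ => Kerr.radius a (p' + θ • v)) 0 ≤ R := by simpa using hpR'
        obtain ⟨θs, hθs, hφθs⟩ := intermediate_value_Icc hℓ₁0.le
          (continuousOn_radius_segment a p' v _) ⟨h0, hc⟩
        exact ⟨θs, hθs, le_of_eq hφθs, Or.inl hφθs⟩
      · have h' : Kerr.radius a (p' + ℓ₁ • v) < R := lt_of_not_ge hc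
        exact ⟨ℓ₁, ⟨hℓ₁0.le, le_rfl⟩, h'.le, Or.inr ⟨rfl, h'⟩⟩
    obtain ⟨θs, hθs, hφle, halt⟩ := hθs
    have hIcc : ∀ θ ∈ Icc (0 : ℝ) θs, θ ∈ Icc (0 : ℝ) ℓ₁ := fun θ hθ => ⟨hθ.1, hθ.2.trans hθs.2⟩
    have hrad_ge : ∀ θ ∈ Icc (0 : ℝ) θs, Kerr.radius a p' + m / 2 * θ ≤ Kerr.radius a (p' + θ • v) := by
      intro θ hθ
      have h1 := (hgrow 0 ⟨le_rfl, hℓ₁0.le⟩ θ (hIcc θ hθ) hθ.1).1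
      rw [zero_smul, add_zero, sub_zero] at h1
      linarith
    have hrad_le : ∀ θ ∈ Icc (0 : ℝ) θs, Kerr.radius a (p' + θ • v) ≤ R := by
      intro θ hθ
      have h1 := (hgrow θ (hIcc θ hθ) θs hθs hθ.2).1
      have h' : 0 ≤ m / 2 * (θs - θ) := mul_nonneg (by positivity) (by linarith [hθ.2])
      linarith
    have hrad_sp : ∀ θ ∈ Icc (0 : ℝ) θs, Kerr.radius a (p' + θ • v) - Kerr.radius a p' ≤ L * θ := by
      intro θ hθ
      have h1 := (hgrow 0 ⟨le_rfl, hℓ₁0.le⟩ θ (hIcc θ hθ) hθ.1).2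
      rw [zero_smul, add_zero, sub_zero] at h1
      exact h1
    have hdom : ∀ θ ∈ Icc (0 : ℝ) θs, p.1 + θ • u ∈ (B.domain : Set E4) := by
      intro θ hθ
      apply hBd
      rw [hrest']
      have h1 := hrad_ge θ hθ
      have h2 : 0 ≤ m / 2 * θ := mul_nonneg (by positivity) hθ.1
      linarith
    have htime_ge : ∀ θ ∈ Icc (0 : ℝ) θs, τ₁ ≤ B.time (p.1 + θ • u) := by
      intro θ hθ; rw [htime_eq]; linarith [hθ.1]
    have hradB_le : ∀ θ ∈ Icc (0 : ℝ) θs, B.radius (p.1 + θ • u) ≤ rp + h := by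
      intro θ hθ; rw [hradB]; exact (hrad_le θ hθ).trans hR
    have hradB_pos : ∀ θ ∈ Icc (0 : ℝ) θs, 0 < Kerr.radius a (poincareInv Λ c (p.1 + θ • u)) := by
      intro θ hθ; rw [hrest']; exact (hkerr θ (hIcc θ hθ)).1
    -- the deviation is `ε`-Lipschitz along the lab segment
    have hlip := deviation_segment_lipschitz 𝓢 B Φ hΦ p.1 u (ℓ := θs) (ε := ε) hdom
      (fun θ hθ => hsmooth _ (hradB_pos θ hθ))
      (fun θ hθ => (hdv ⟨p.1 + θ • u, hdom θ hθ⟩ (htime_ge θ hθ) (hradB_le θ hθ)).2)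
    -- causal (indeed timelike) velocities along the segment
    have hcausal : ∀ θ ∈ Icc (0 : ℝ) θs, ∀ hz : p.1 + θ • u ∈ (B.domain : Set E4),
        𝓢.metric.IsCausal (mfderiv 𝓘(ℝ, E4) (𝓡 4) Φ ⟨p.1 + θ • u, hz⟩ u) := by
      intro θ hθ hz
      have hdθ : ‖𝓢.deviation B Φ ⟨p.1 + θ • u, hz⟩ - 𝓢.deviation B Φ p‖ ≤ ε * ‖u‖ * θ := by
        have h1 := hlip θ hθ
        rwa [← 𝓢.deviationExtend_coe B Φ ⟨p.1 + θ • u, hz⟩, ← 𝓢.deviationExtend_coe B Φ p]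
      have h1 := val_mfderiv_le_of_sub 𝓢 B Φ p ⟨p.1 + θ • u, hz⟩ hdθ u
      have h2 : B.bilin (⟨p.1 + θ • u, hz⟩ : B.domain).1 u u - B.bilin p.1 u u ≤ m / 4 := by
        have h3 := hBuu θ
        have h4 := hBuu 0
        rw [zero_smul, add_zero] at h4
        have h5 := (hkerr θ (hIcc θ hθ)).2.1
        show B.bilin (p.1 + θ • u) u u - B.bilin p.1 u u ≤ m / 4
        rw [zero_smul, add_zero] at h4
        linarith
      have h3 : ε * ‖u‖ * θ * ‖u‖ * ‖u‖ ≤ m / 4 := by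
        have hθℓ : θ ≤ ℓ₁ := hθ.2.trans hθs.2
        calc ε * ‖u‖ * θ * ‖u‖ * ‖u‖ ≤ ε * (KΛ * K₁) * ℓ₁ * (KΛ * K₁) * (KΛ * K₁) := by
              have := norm_nonneg u
              apply mul_le_mul (mul_le_mul (mul_le_mul (mul_le_mul_of_nonneg_left huK hε0.le) hθℓ hθ.1
                (by positivity)) huK this (by positivity)) huK this (by positivity)
          _ ≤ m / 4 := hℓ₁ε
      have hlt : 𝓢.metric.val (Φ ⟨p.1 + θ • u, hz⟩) (mfderiv 𝓘(ℝ, E4) (𝓡 4) Φ ⟨p.1 + θ • u, hz⟩ u)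
          (mfderiv 𝓘(ℝ, E4) (𝓡 4) Φ ⟨p.1 + θ • u, hz⟩ u) < 0 := by linarith
      exact ⟨hlt.le, fun h0 => by rw [h0] at hlt; simp at hlt⟩
    -- future-directedness at the start of the segment (same cone as `dΦ(ΛV)`)
    have hfd0 : 𝓢.timeOrientation.IsFutureDirected (mfderiv 𝓘(ℝ, E4) (𝓡 4) Φ p u) := by
      have hph' : B.radius p.1 ≤ rp + h := by rw [hradp]; exact hph
      have hV := hfd p hp0 hph'
      rw [hp'] at hV
      have hd := (hdv p hp0 hph').1
      have hVK : ‖Kerr.timeVector M a p'‖ ≤ CV := (hbd p' hprp hph).1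
      have h1 := val_mfderiv_le 𝓢 B Φ p hd
        ((Λ : E4 ≃L[ℝ] E4) (Kerr.timeVector M a p')) ((Λ : E4 ≃L[ℝ] E4) (Kerr.timeVector M a p'))
      have h2 := val_mfderiv_le 𝓢 B Φ p hd ((Λ : E4 ≃L[ℝ] E4) (Kerr.timeVector M a p')) u
      rw [hBuv, hp'] at h1
      rw [← hu, hBuv, hp', hu] at h2
      obtain ⟨hVV, hV0, -⟩ := timeVector_facts hM.le hr0'
      have hVv : Kerr.bilin M a p' (Kerr.timeVector M a p') v = -1 := by
        rw [Kerr.bilin_timeVector (M := M) hr0' v]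
        show -(v 0) = -1
        rw [hv0]
      have hn1 := hεVV _ hVK
      have hn2 := hεVu _ hVK v hvK₁
      rw [hu] at hn2
      have hVt : 𝓢.metric.IsTimelike
          (mfderiv 𝓘(ℝ, E4) (𝓡 4) Φ p ((Λ : E4 ≃L[ℝ] E4) (Kerr.timeVector M a p'))) := by
        show 𝓢.metric.val _ _ _ < 0
        linarith
      have huc : 𝓢.metric.IsCausal (mfderiv 𝓘(ℝ, E4) (𝓡 4) Φ p u) := by
        have hlt : 𝓢.metric.val (Φ p) (mfderiv 𝓘(ℝ, E4) (𝓡 4) Φ p u)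
            (mfderiv 𝓘(ℝ, E4) (𝓡 4) Φ p u) < 0 := by linarith
        exact ⟨hlt.le, fun h0 => by rw [h0] at hlt; simp at hlt⟩
      have hcross : 𝓢.metric.val (Φ p)
          (mfderiv 𝓘(ℝ, E4) (𝓡 4) Φ p ((Λ : E4 ≃L[ℝ] E4) (Kerr.timeVector M a p')))
          (mfderiv 𝓘(ℝ, E4) (𝓡 4) Φ p u) < 0 := by linarith
      exact 𝓢.timeOrientation.isFutureDirected_of_val_lt_zero hV hVt huc hcross
    -- conclusion of the piece
    rcases eq_or_lt_of_le hθs.1 with h0 | hpos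
    · -- degenerate cut `θs = 0`: the point `p` is already on `{r = R}`
      have hRe : B.radius p.1 = R := by
        rcases halt with h1 | ⟨h1, _⟩
        · rw [← h0, zero_smul, add_zero] at h1
          rw [hradp]; exact h1
        · exfalso; linarith
      refine ⟨p, LorentzianMetric.subset_causalFuture _ _ _ rfl, hp0, hp1, hpR, ?_, Or.inl hRe⟩
      rw [sub_self, zero_div, add_zero]
    · have key := BoostedKerrLegs.leg_two_causal 𝓢 B Φ B.domain.isOpen (fun _ hz => hz)
        hΦ.contMDiffOn p.1 u hpos (fun θ hθ => hdom θ hθ) hcausal p.2 (hdom θs ⟨hθs.1, le_rfl⟩) hfd0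
      refine ⟨⟨p.1 + θs • u, hdom θs ⟨hθs.1, le_rfl⟩⟩, key, htime_ge θs ⟨hθs.1, le_rfl⟩, ?_, ?_, ?_, ?_⟩
      · show rp + dm ≤ B.radius (p.1 + θs • u)
        rw [hradB]
        have h1 := hrad_ge θs ⟨hθs.1, le_rfl⟩
        have h2 : 0 ≤ m / 2 * θs := mul_nonneg (by positivity) hθs.1
        linarith
      · show B.radius (p.1 + θs • u) ≤ R
        rw [hradB]; exact hφle
      · show B.time p.1 + (B.radius (p.1 + θs • u) - B.radius p.1) / L ≤ B.time (p.1 + θs • u)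
        rw [htime_eq, hradB, hradp, hBt, hp']
        have h1 := hrad_sp θs ⟨hθs.1, le_rfl⟩
        have h2 : (Kerr.radius a (p' + θs • v) - Kerr.radius a p') / L ≤ θs := by
          rw [div_le_iff₀ hL0]; linarith
        linarith
      · show B.radius (p.1 + θs • u) = R ∨ B.radius p.1 + η₁ ≤ B.radius (p.1 + θs • u)
        rw [hradB, hradp]
        rcases halt with h1 | ⟨hθℓ, _⟩
        · exact Or.inl h1
        · right
          rw [hθℓ]
          have h1 := hrad_ge ℓ₁ ⟨hℓ₁0.le, hθℓ ▸ le_rfl⟩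
          rw [hη₁]
          linarith
  /- IN PIECE: from a late chart point `p` with `rp ≤ R' ≤ r(p) ≤ rp + h`, a frozen segment along
  `Λ V(p)` cut at `r = R'`: causal future, radius nonincreasing with loss `≥ η₂` unless cut. -/
  have stepIn : ∀ p : B.domain, τ₁ ≤ B.time p.1 → ∀ R' : ℝ, rp ≤ R' → R' ≤ B.radius p.1 →
      B.radius p.1 ≤ rp + h →
      ∃ q : B.domain, Φ q ∈ 𝓢.metric.causalFuture 𝓢.timeOrientation {Φ p} ∧
        τ₁ ≤ B.time q.1 ∧ B.time p.1 ≤ B.time q.1 ∧ R' ≤ B.radius q.1 ∧ B.radius q.1 ≤ rp + h ∧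
        (B.radius q.1 = R' ∨ B.radius q.1 + η₂ ≤ B.radius p.1) := by
    intro p hp0 R' hR' hpR' hph
    obtain ⟨p', hp'⟩ : ∃ p' : E4, poincareInv Λ c p.1 = p' := ⟨_, rfl⟩
    have hp0' : τ₁ ≤ p' 0 := by rw [← hp', ← hBt]; exact hp0
    have hradp : B.radius p.1 = Kerr.radius a p' := by rw [hBr, hp']
    have hpR'' : R' ≤ Kerr.radius a p' := hradp ▸ hpR'
    have hph' : Kerr.radius a p' ≤ rp + h := hradp ▸ hph
    have hprp : rp ≤ Kerr.radius a p' := hR'.trans hpR''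
    have hr0' : 0 < Kerr.radius a p' := by linarith
    -- the frozen ingoing vector
    obtain ⟨V, hV⟩ : ∃ V : E4, Kerr.timeVector M a p' = V := ⟨_, rfl⟩
    have hVK : ‖V‖ ≤ CV := hV ▸ (hbd p' hprp hph').1
    obtain ⟨hVV, hV0, hdrV⟩ := timeVector_facts hM.le hr0'
    rw [hV] at hVV hV0 hdrV
    have hV00 : 0 ≤ V 0 := by
      have : V 0 = (V : E4).ofLp 0 := rfl
      linarith
    obtain ⟨u, hu⟩ : ∃ u : E4, (Λ : E4 ≃L[ℝ] E4) V = u := ⟨_, rfl⟩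
    have hnu : ε * ‖u‖ * ‖u‖ ≤ 1 / 4 := by rw [← hu]; exact hεVV V hVK
    -- rest data along the lab segment `p + θ u`
    have hrest' : ∀ θ : ℝ, poincareInv Λ c (p.1 + θ • u) = p' + θ • V := fun θ => by
      rw [← hu, hrest, hp']
    have hBuu : ∀ θ : ℝ, B.bilin (p.1 + θ • u) u u = Kerr.bilin M a (p' + θ • V) V V := fun θ => by
      rw [← hu, hBuv, hu, hrest']
    have htime_eq : ∀ θ : ℝ, B.time (p.1 + θ • u) = p' 0 + θ * V 0 := fun θ => by
      rw [← hu, htime_seg, hp']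
    have hradB : ∀ θ : ℝ, B.radius (p.1 + θ • u) = Kerr.radius a (p' + θ • V) := fun θ => by
      rw [← hu, hrad_seg, hp']
    -- Kerr moduli along the rest segment `p' + θ V`, `0 ≤ θ ≤ ℓ₂`
    have hclose : ∀ θ ∈ Icc (0 : ℝ) ℓ₂, ‖tn (p' + θ • V) - tn p'‖ < ρ := by
      intro θ hθ
      rw [tn_add_smul, add_sub_cancel_left, norm_smul, Real.norm_eq_abs, abs_of_nonneg hθ.1]
      calc θ * ‖tn V‖ ≤ ℓ₂ * CV := mul_le_mul hθ.2 ((norm_tn_le V).trans hVK) (norm_nonneg _) hℓ₂0.le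
        _ = ρ / 2 := hℓ₂ρ
        _ < ρ := by linarith
    have hkerr : ∀ θ ∈ Icc (0 : ℝ) ℓ₂, 0 < Kerr.radius a (p' + θ • V) ∧
        Kerr.bilin M a (p' + θ • V) V V ≤ -(3 / 4) ∧
        Kerr.bilin M a (p' + θ • V) (Kerr.radiusGradVector M a (p' + θ • V)) V ≤ -(cH / 2) ∧
        -(CW * CV + cH) ≤ Kerr.bilin M a (p' + θ • V) (Kerr.radiusGradVector M a (p' + θ • V)) V := by
      intro θ hθ
      obtain ⟨hpos, hG, hF⟩ := hmod p' hprp hph' (p' + θ • V) (hclose θ hθ)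
      have hmV : mt * ‖V‖ * ‖V‖ ≤ 1 / 4 := by
        calc mt * ‖V‖ * ‖V‖ ≤ 1 / (4 * CV ^ 2) * CV * CV :=
              mul_le_mul (mul_le_mul hmt2 hVK (norm_nonneg _) (by positivity)) hVK (norm_nonneg _)
                (by positivity)
          _ = 1 / 4 := by field_simp
      have hmV' : mt * ‖V‖ ≤ cH / 2 := by
        calc mt * ‖V‖ ≤ cH / (2 * CV) * CV := mul_le_mul hmt3 hVK (norm_nonneg _) (by positivity)
          _ = cH / 2 := by field_simp
      have hHp := hcH p' hprp hph'
      refine ⟨hpos, ?_, ?_, ?_⟩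
      · have h1 := bilin_sub_apply_le (Kerr.bilin M a (p' + θ • V)) (Kerr.bilin M a p') V V
        have h2 : ‖Kerr.bilin M a (p' + θ • V) - Kerr.bilin M a p'‖ * ‖V‖ * ‖V‖ ≤ mt * ‖V‖ * ‖V‖ := by
          gcongr
        linarith
      · have h1 := (form_sub_apply_le (Kerr.bilin M a (p' + θ • V) (Kerr.radiusGradVector M a (p' + θ • V)))
          (Kerr.bilin M a p' (Kerr.radiusGradVector M a p')) V).2
        have h2 : ‖Kerr.bilin M a (p' + θ • V) (Kerr.radiusGradVector M a (p' + θ • V)) -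
            Kerr.bilin M a p' (Kerr.radiusGradVector M a p')‖ * ‖V‖ ≤ mt * ‖V‖ := by gcongr
        linarith
      · have h1 := (form_sub_apply_le (Kerr.bilin M a (p' + θ • V) (Kerr.radiusGradVector M a (p' + θ • V)))
          (Kerr.bilin M a p' (Kerr.radiusGradVector M a p')) V).1
        have h2 : ‖Kerr.bilin M a (p' + θ • V) (Kerr.radiusGradVector M a (p' + θ • V)) -
            Kerr.bilin M a p' (Kerr.radiusGradVector M a p')‖ * ‖V‖ ≤ mt * ‖V‖ := by gcongr
        have h3 : -(CW * CV) ≤ Kerr.bilin M a p' (Kerr.radiusGradVector M a p') V := by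
          have h4 := Real.le_norm_self (-(Kerr.bilin M a p' (Kerr.radiusGradVector M a p') V))
          rw [norm_neg] at h4
          have h5 := ((Kerr.bilin M a p' (Kerr.radiusGradVector M a p')).le_opNorm V).trans
            (mul_le_mul (hbd p' hprp hph').2 hVK (norm_nonneg _) hCW0.le)
          linarith
        linarith
    -- radius monotonicity along the rest segment
    have hgrow := radius_segment_mvt M a p' V (fun θ hθ => (hkerr θ hθ).1)
      (fun θ hθ => (hkerr θ hθ).2.2.2) (fun θ hθ => (hkerr θ hθ).2.2.1)
    -- the cut parameter
    have hθs : ∃ θs ∈ Icc (0 : ℝ) ℓ₂, R' ≤ Kerr.radius a (p' + θs • V) ∧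
        (Kerr.radius a (p' + θs • V) = R' ∨ (θs = ℓ₂ ∧ R' < Kerr.radius a (p' + ℓ₂ • V))) := by
      by_cases hc : Kerr.radius a (p' + ℓ₂ • V) ≤ R'
      · have h0 : R' ≤ (fun θ : ℝ => Kerr.radius a (p' + θ • V)) 0 := by simpa using hpR''
        obtain ⟨θs, hθs, hφθs⟩ := intermediate_value_Icc' hℓ₂0.le
          (continuousOn_radius_segment a p' V _) ⟨hc, h0⟩
        exact ⟨θs, hθs, le_of_eq hφθs.symm, Or.inl hφθs⟩
      · have h' : R' < Kerr.radius a (p' + ℓ₂ • V) := lt_of_not_ge hc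
        exact ⟨ℓ₂, ⟨hℓ₂0.le, le_rfl⟩, h'.le, Or.inr ⟨rfl, h'⟩⟩
    obtain ⟨θs, hθs, hφge, halt⟩ := hθs
    have hIcc : ∀ θ ∈ Icc (0 : ℝ) θs, θ ∈ Icc (0 : ℝ) ℓ₂ := fun θ hθ => ⟨hθ.1, hθ.2.trans hθs.2⟩
    have hrad_le : ∀ θ ∈ Icc (0 : ℝ) θs, Kerr.radius a (p' + θ • V) + cH / 2 * θ ≤ Kerr.radius a p' := by
      intro θ hθ
      have h1 := (hgrow 0 ⟨le_rfl, hℓ₂0.le⟩ θ (hIcc θ hθ) hθ.1).2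
      rw [zero_smul, add_zero, sub_zero] at h1
      linarith
    have hrad_ge : ∀ θ ∈ Icc (0 : ℝ) θs, R' ≤ Kerr.radius a (p' + θ • V) := by
      intro θ hθ
      have h1 := (hgrow θ (hIcc θ hθ) θs hθs hθ.2).2
      have h' : 0 ≤ cH / 2 * (θs - θ) := mul_nonneg (by positivity) (by linarith [hθ.2])
      linarith
    have hdom : ∀ θ ∈ Icc (0 : ℝ) θs, p.1 + θ • u ∈ (B.domain : Set E4) := by
      intro θ hθ
      apply hBd
      rw [hrest']
      linarith [hrad_ge θ hθ]
    have htime_ge : ∀ θ ∈ Icc (0 : ℝ) θs, τ₁ ≤ B.time (p.1 + θ • u) := by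
      intro θ hθ; rw [htime_eq]
      have : 0 ≤ θ * V 0 := mul_nonneg hθ.1 hV00
      linarith
    have hradB_le : ∀ θ ∈ Icc (0 : ℝ) θs, B.radius (p.1 + θ • u) ≤ rp + h := by
      intro θ hθ; rw [hradB]
      have h1 := hrad_le θ hθ
      have h2 : 0 ≤ cH / 2 * θ := mul_nonneg (by positivity) hθ.1
      linarith
    -- causal (indeed timelike) velocities along the segment
    have hcausal : ∀ θ ∈ Icc (0 : ℝ) θs, ∀ hz : p.1 + θ • u ∈ (B.domain : Set E4),
        𝓢.metric.IsCausal (mfderiv 𝓘(ℝ, E4) (𝓡 4) Φ ⟨p.1 + θ • u, hz⟩ u) := by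
      intro θ hθ hz
      have hd := (hdv ⟨p.1 + θ • u, hz⟩ (htime_ge θ hθ) (hradB_le θ hθ)).1
      have h1 := val_mfderiv_le 𝓢 B Φ ⟨p.1 + θ • u, hz⟩ hd u u
      have h2 : B.bilin (⟨p.1 + θ • u, hz⟩ : B.domain).1 u u = Kerr.bilin M a (p' + θ • V) V V := hBuu θ
      rw [h2] at h1
      have h3 := (hkerr θ (hIcc θ hθ)).2.1
      have hlt : 𝓢.metric.val (Φ ⟨p.1 + θ • u, hz⟩) (mfderiv 𝓘(ℝ, E4) (𝓡 4) Φ ⟨p.1 + θ • u, hz⟩ u)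
          (mfderiv 𝓘(ℝ, E4) (𝓡 4) Φ ⟨p.1 + θ • u, hz⟩ u) < 0 := by linarith
      exact ⟨hlt.le, fun h0 => by rw [h0] at hlt; simp at hlt⟩
    -- future-directedness at the start: `u = Λ V(p')` is the hypothesis (2)
    have hfd0 : 𝓢.timeOrientation.IsFutureDirected (mfderiv 𝓘(ℝ, E4) (𝓡 4) Φ p u) := by
      have h1 := hfd p hp0 hph
      rw [hp', hV, hu] at h1
      exact h1
    -- conclusion of the piece
    rcases eq_or_lt_of_le hθs.1 with h0 | hpos
    · have hRe : B.radius p.1 = R' := by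
        rcases halt with h1 | ⟨h1, _⟩
        · rw [← h0, zero_smul, add_zero] at h1
          rw [hradp]; exact h1
        · exfalso; linarith
      exact ⟨p, LorentzianMetric.subset_causalFuture _ _ _ rfl, hp0, le_rfl, hpR', hph, Or.inl hRe⟩
    · have key := BoostedKerrLegs.leg_two_causal 𝓢 B Φ B.domain.isOpen (fun _ hz => hz)
        hΦ.contMDiffOn p.1 u hpos (fun θ hθ => hdom θ hθ) hcausal p.2 (hdom θs ⟨hθs.1, le_rfl⟩) hfd0
      refine ⟨⟨p.1 + θs • u, hdom θs ⟨hθs.1, le_rfl⟩⟩, key, htime_ge θs ⟨hθs.1, le_rfl⟩, ?_, ?_,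
        hradB_le θs ⟨hθs.1, le_rfl⟩, ?_⟩
      · show B.time p.1 ≤ B.time (p.1 + θs • u)
        rw [htime_eq, hBt, hp']
        have : 0 ≤ θs * V 0 := mul_nonneg hθs.1 hV00
        linarith
      · show R' ≤ B.radius (p.1 + θs • u)
        rw [hradB]; exact hφge
      · show B.radius (p.1 + θs • u) = R' ∨ B.radius (p.1 + θs • u) + η₂ ≤ B.radius p.1
        rw [hradB, hradp]
        rcases halt with h1 | ⟨hθℓ, _⟩
        · exact Or.inl h1
        · right
          rw [hθℓ]
          have h1 := hrad_le ℓ₂ ⟨hℓ₂0.le, hθℓ ▸ le_rfl⟩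
          rw [hη₂]
          linarith
  /- OUT PHASE: at most `n` out pieces reach the level `{r = R}`. -/
  have outPhase : ∀ n : ℕ, ∀ p : B.domain, τ₁ ≤ B.time p.1 → rp + dm ≤ B.radius p.1 → ∀ R : ℝ,
      B.radius p.1 ≤ R → R ≤ rp + h → R - n * η₁ ≤ B.radius p.1 →
      ∃ q : B.domain, B.radius q.1 = R ∧ τ₁ ≤ B.time q.1 ∧
        B.time p.1 + (R - B.radius p.1) / L ≤ B.time q.1 ∧
        Φ q ∈ 𝓢.metric.causalFuture 𝓢.timeOrientation {Φ p} := by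
    intro n
    induction n with
    | zero =>
      intro p hp0 hp1 R hpR hR hgap
      simp only [Nat.cast_zero, zero_mul, sub_zero] at hgap
      have hRe : B.radius p.1 = R := le_antisymm hpR hgap
      refine ⟨p, hRe, hp0, ?_, LorentzianMetric.subset_causalFuture _ _ _ rfl⟩
      rw [hRe, sub_self, zero_div, add_zero]
    | succ n ih =>
      intro p hp0 hp1 R hpR hR hgap
      obtain ⟨q, hJ, hq0, hq1, hqR, htq, halt⟩ := stepOut p hp0 hp1 R hpR hR
      rcases halt with hhit | hgain
      · exact ⟨q, hhit, hq0, hhit ▸ htq, hJ⟩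
      · obtain ⟨x, hx, hx0, htx, hJ'⟩ := ih q hq0 hq1 R hqR hR (by push_cast at hgap ⊢; linarith)
        refine ⟨x, hx, hx0, ?_, mem_causalFuture_trans' 𝓢 hJ hJ'⟩
        have h1 : (R - B.radius p.1) / L = (B.radius q.1 - B.radius p.1) / L + (R - B.radius q.1) / L := by
          rw [← add_div]; ring_nf
        linarith
  /- IN PHASE: at most `n` in pieces reach the level `{r = R'}`. -/
  have inPhase : ∀ n : ℕ, ∀ p : B.domain, τ₁ ≤ B.time p.1 → ∀ R' : ℝ, rp ≤ R' → R' ≤ B.radius p.1 →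
      B.radius p.1 ≤ rp + h → B.radius p.1 ≤ R' + n * η₂ →
      ∃ q : B.domain, B.radius q.1 = R' ∧ τ₁ ≤ B.time q.1 ∧ B.time p.1 ≤ B.time q.1 ∧
        Φ q ∈ 𝓢.metric.causalFuture 𝓢.timeOrientation {Φ p} := by
    intro n
    induction n with
    | zero =>
      intro p hp0 R' hR' hpR' hph hgap
      simp only [Nat.cast_zero, zero_mul, add_zero] at hgap
      exact ⟨p, le_antisymm hgap hpR', hp0, le_rfl, LorentzianMetric.subset_causalFuture _ _ _ rfl⟩
    | succ n ih =>
      intro p hp0 R' hR' hpR' hph hgap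
      obtain ⟨q, hJ, hq0, htq, hqR, hqh, halt⟩ := stepIn p hp0 R' hR' hpR' hph
      rcases halt with hhit | hgain
      · exact ⟨q, hhit, hq0, htq, hJ⟩
      · obtain ⟨x, hx, hx0, htx, hJ'⟩ := ih q hq0 R' hR' hqR hqh (by push_cast at hgap ⊢; linarith)
        exact ⟨x, hx, hx0, htq.trans htx, mem_causalFuture_trans' 𝓢 hJ hJ'⟩
  -- numbers of pieces per phase
  obtain ⟨N₁, hN₁⟩ := exists_nat_ge (h / 2 / η₁)
  obtain ⟨N₂, hN₂⟩ := exists_nat_ge (h / 4 / η₂)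
  have hN₁' : h / 2 ≤ N₁ * η₁ := (div_le_iff₀ hη₁0).1 hN₁
  have hN₂' : h / 4 ≤ N₂ * η₂ := (div_le_iff₀ hη₂0).1 hN₂
  /- CYCLES: from the level `{r = rp + h/2}`, `k` out–in cycles to `{r = rp + 3h/4}` and back gain rest
  time `≥ k · tg`. -/
  have cycles : ∀ k : ℕ, ∀ p : B.domain, τ₁ ≤ B.time p.1 → B.radius p.1 = rp + h / 2 →
      ∃ q : B.domain, B.radius q.1 = rp + h / 2 ∧ τ₁ ≤ B.time q.1 ∧ B.time p.1 + k * tg ≤ B.time q.1 ∧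
        Φ q ∈ 𝓢.metric.causalFuture 𝓢.timeOrientation {Φ p} := by
    intro k
    induction k with
    | zero =>
      intro p hp0 hpr
      refine ⟨p, hpr, hp0, ?_, LorentzianMetric.subset_causalFuture _ _ _ rfl⟩
      simp
    | succ k ih =>
      intro p hp0 hpr
      obtain ⟨q₁, hq₁r, hq₁0, htq₁, hJ₁⟩ := outPhase N₁ p hp0 (by rw [hpr]; linarith) (rp + 3 * h / 4)
        (by rw [hpr]; linarith) (by linarith) (by rw [hpr]; linarith)
      obtain ⟨q₂, hq₂r, hq₂0, htq₂, hJ₂⟩ := inPhase N₂ q₁ hq₁0 (rp + h / 2) (by linarith)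
        (by rw [hq₁r]; linarith) (by rw [hq₁r]; linarith) (by rw [hq₁r]; linarith)
      obtain ⟨q, hqr, hq0, htq, hJ⟩ := ih q₂ hq₂0 hq₂r
      refine ⟨q, hqr, hq0, ?_, mem_causalFuture_trans' 𝓢 hJ₁ (mem_causalFuture_trans' 𝓢 hJ₂ hJ)⟩
      have h1 : (rp + 3 * h / 4 - B.radius p.1) / L = tg := by
        rw [hpr, htg]; ring_nf
      rw [h1] at htq₁
      push_cast
      linarith
  -- conclusion: climb to the level, then `⌈T₀ / tg⌉` cycles
  obtain ⟨k₀, hk₀⟩ := exists_nat_ge (T₀ / tg)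
  have hk₀' : T₀ ≤ k₀ * tg := (div_le_iff₀ htg0).1 hk₀
  have hw1' : rp + dm ≤ B.radius w.1 := by linarith
  obtain ⟨q₀, hq₀r, hq₀0, htq₀, hJ₀⟩ := outPhase N₁ w hw0 hw1' (rp + h / 2) hw2 (by linarith)
    (by linarith)
  obtain ⟨q, hqr, hq0, htq, hJ⟩ := cycles k₀ q₀ hq₀0 hq₀r
  refine ⟨q, hqr, ?_, mem_causalFuture_trans' 𝓢 hJ₀ hJ⟩
  have h1 : 0 ≤ (rp + h / 2 - B.radius w.1) / L := div_nonneg (by linarith) hL0.le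
  linarith

end Chart

end KerrPeel

end Literature.Geometry.Lorentzian
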